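import Summits.BirchSwinnertonDyer.BirchSwinnertonDyer.Theorems.KatoDescentTamePotSupersingularCartanMuRoadDoorsTprimeFive
import Summits.BirchSwinnertonDyer.BirchSwinnertonDyer.Theorems.KatoDescentTamePotSupersingularCartanMuRoadFukudaDoorsTprime
import Summits.BirchSwinnertonDyer.BirchSwinnertonDyer.Theorems.AdditiveBranchIMCGordTwoRankOneSmallImageDickson
import Summits.BirchSwinnertonDyer.BirchSwinnertonDyer.Theorems.KatoDescentTamePotSupersingularTameUpperUnitTwistRecordsImageFive06
import Summits.BirchSwinnertonDyer.BirchSwinnertonDyer.Theorems.KatoDescentTamePotSupersingularTameUpperUnitTwistRecordsImageFive09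
import Literature.NumberTheory.EllipticCurves.FineSelmerTorsionPointFieldMuRoad
import Literature.NumberTheory.EllipticCurves.FineSelmerCentralLayerDoors
import Literature.NumberTheory.EllipticCurves.Rank1Residual.MuLambdaCarriers
import HarnessLib

/-!
# Route `KatoDescentTamePotSupersingular` (rung K8-t′ / KT, sub-rung B4 (t′) `p = 5`, cell `bsd-potss`): per-row records on the FACT-FREE door L8 with
# FUKUDA'S TWO-LAYER ORDER TEST at the torsion-point field `ℚ(P)` of an EIGENLINE point — statement (A) of Coates–Sujatha at `(E, 5)` with NO named fact,
# and U₀ modulo `hKatoA hGZK hmod`, part 01: 235200xb1, 338800ex1 (seat `bsd-potss-conjA-anchor` g27; `--supports stmt-BirchSwinnertonDyer-19413 --as helper`)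

HONEST FRAMING. THEOREMS ONLY (no definition, no named fact, no `sorry`); PER ROW — NOT a class theorem; nothing is booked; items 19413 (aside
`TameFineSelmerCoatesSujatha`, stub `stub_fineA_tame_five_le`) / 19202 / 19982 stay OPEN at class level; Conjecture A and BSD are proved for NO class of
curves.  Each row theorem is CONDITIONAL on ONE displayed numerical hypothesis about ONE octic number field and its first cyclotomic layer (class numbers;
the layer under GRH), which is NOT certified in the kernel.

WHY THESE TWO ROWS.  Both are `5Ns` rows of the KT U₀-ns (t′) table whose `5`-class group of `L = ℚ(E[5])` CONTAINS `E[5]` as a Galois constituent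
(«E[5]-isotypic at layer 0», k8t-c4 g26 kit j334494 / census `RANKEQ-CENSUS-p5-k8t-c4-g26.tsv`: `rank₅ Cl(ℚ(P)) = 1 > rank₅ Cl(ℚ(x(P))) = 0`), so EVERY
layer-0 class-group door of the cell is void for them by construction (DRS (c2), door L6 (c2*)₀, rank-equality, Selmer-trivial is VACUOUS here: the
Records03 theorems p749782 carry a false displayed clause at the split multiplicative prime, k8t-c4 STATUS 2026-08-29T23:07:50Z), and congruence anchors
cannot help ((c2*) depends on `E[5]` alone).  Door L8 is NOT a layer-0 door: it reads `μ₅(ℚ(P)_cyc) = 0` off Fukuda's finite two-layer test at the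
SMALLEST field carrying a `ρ̄`-fixed vector, `ℚ(P)` for `P` on an eigenline of the split Cartan group (degree `8`, first layer degree `40` — computable;
for the `5Nn`/`5S4` isotypic rows 119025ck1, 396900eb1, 110450bj1 the smallest such field has degree `24`, first layer `120`, out of reach).

ROAD (door L8 of conjA-anchor g19, `CoatesSujatha2005.conjA_of_classNumberPExp_stabilizerField_succ_eq`, a KERNEL theorem — Literature p707276; generic odd
`p`, here `p = 5`, `n = 0`): `E[p]` irreducible (kernel `irr_g…_5`) and `ρ̄_{E,5}` NOT onto (kernel `notSurjFive_g…`: Zywina's `G₉`-line, tree theorem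
`zywina2015_thm14_not_surjective_five_of_j_eq_J9_holds`) ⟹ `5 ∤ #Gal(ℚ(E[5])/ℚ)` (Serre Prop. 15, tree theorem `SmallImageDickson.not_dvd_card_aut_divisionField`)
⟹ tameness for door L8 AND Fukuda index `0` for every cyclotomic `ℤ₅`-extension of `ℚ(P) = ℚ̄^{Stab(P)} ⊆ ℚ(E[5])`
(`CartanMuRoadFukudaDoorsTprime.totallyRamifiedFrom_zero_of_isCyclotomic_of_algHom_normal_of_not_dvd_card`) — all in the KERNEL; plus ONE DISPLAYED
hypothesis `hord`: **there is a non-zero `P ∈ E[5]` such that for every cyclotomic `ℤ₅`-extension `κ_P` of `ℚ(P)`: `ord₅ h(ℚ(P)₁) = ord₅ h(ℚ(P))`**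
⟹ (Fukuda 1994 Thm. 1 (1) at finite level, tree theorem inside door L8) `μ₅(ℚ(P)_cyc) = 0` with bounded ranks ⟹ statement (A) at `(E, 5)` for every
cyclotomic `ℤ₅`-extension of `ℚ` (typed carrier `Rank1Residual.ConjAAt E 5` as well); and U₀ `MissingUpperBoundAt E 5` modulo `hKatoA hGZK hmod` +
Cremona's `r_an = 0` (k8t-c4's route-free `CartanMuRoadDoorsTprimeFive.missingUpperBoundAt_tame_of_conjA`; kernel `addv_/subTprime_/irr_`).  NO
Ferrero–Washington, NO Iwasawa-growth fact, NO six-leaf norm relation (this is what separates these records from the split-Cartan μ-road doors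
`CartanMuRoadSplitFiveAbelDoors.*`, which need class data on SIX leaves of `ℚ(E[5])`; door L8 needs `μ = 0` at ONE `ℚ(P)` ONLY).
The displayed hypothesis is EXISTENTIAL in `P` on purpose: the image `C_s⁺(5)` has TWO orbits on `E[5] ∖ 0` (eigenline points: `[ℚ(P):ℚ] = 8`;
the others: `16`); the numerics below concern the eigenline orbit only (all eight eigenline points give conjugate octics), and nothing is displayed
about the degree-`16` fields.

NUMERICS (all GRH at the layer; nothing certified in the kernel; the identification of the Lean field `fixedField (Stab P)` with `ℚ[x]/(octic)` is the
census memos', not a kernel statement):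
* `338800ex1`: conjA-anchor g9, kit **j296284** (`mudesc.gp`, PARI/GP 2.17; RESULT `run/shared/lean/pub/bsd-potss/conjA-anchor/g9/kit/results/j296284/result.txt`
  l.640–644): `ℚ(P) ≅ ℚ[x]/(x^8 + 605x^2 + 2420)` (the field of an eigenline point: `ψ₅` factors with degrees `[4, 8]`), `h = 160`, `Cl = [40,2,2]`,
  `bnfcertify`: CERTIFIED, ONE prime above `5` (`e = 8`); first layer `ℚ(P)₁ = ℚ(P)·ℚ₁` (degree `40`; `ℚ₁ ⊂ ℚ(ζ₂₅)` the quintic; ONE prime above `5`,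
  `e = 40`): `h = 11360 = 2^5·5·71`, `Cl = [2840,2,2]`, so `ord₅ h(ℚ(P)₁) = 1 = ord₅ h(ℚ(P))` and `rank₅ = 1` («FUKUDA1(0,1): e=1», GRH, 3853 s).  Second engine (g15's `l5layer1.gp` sha16 15e7417a522cee9d on this row): kit **j336753** (this seat, done 2026-08-29T23:55Z, 1941 s) CONFIRMS
  digit for digit: the SAME octic `y^8 + 605y^2 + 2420` (h = 160, [40,2,2], CERT), layer 1 `h = 11360`, `Cl = [2840,2,2]`, `ord₅ = 1`, `rank₅ = 1` (GRH);
  extra: `γ` acts trivially on `Cl(ℚ(P)₁)/5`, the layer-0 class maps to `0` there, and the class of a prime above `7` spans it.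
* `235200xb1`: conjA-anchor g15, kit **j312330** (`l5layer1.gp`; RESULT `…/conjA-anchor/g15/kit/results/L5B-xb1-layer1-FULL-j312330-result.txt`) and g13 kit
  j309704 (independent run, flag 1): `ℚ(P) ≅ ℚ[y]/(y^8 - 4y^7 + 82y^6 - 92y^5 + 2240y^4 + 872y^3 + 33602y^2 + 24304y + 186921)`, `h = 80`, `Cl = [40,2]`,
  CERTIFIED, ONE prime above `5` (`e = 8`); first layer degree `40`: `h = 14080`, `Cl = [440,2,2,2,2,2]`, `ord₅ h = 1`, `rank₅ = 1` (GRH, 14987 s).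
KERNEL lemmas `isElliptic_g…`, `isGloballyMinimal_g…`, `irr_g…_5`, `addv_g…_5`, `jint_g…_5`, `subTprime_g…_5` (`…TameUpperUnitTwistRecordsSharp35/38`) and
`notSurjFive_g…` (`…TameUpperUnitTwistRecordsImageFive06/09`) are IMPORTED.

References: [CoatesSujatha2005] Thm. 3.4, Lemma 3.8; [Fukuda1994] Thm. 1 (1), p. 264; [Washington1997] §13.3 Lemma 13.18, Prop. 13.22–13.23; [Serre1972] §2.4
Prop. 15; [Zywina2015] Thm. 1.4; [Kato2004Asterisque] Thm. 14.5 (3), Thm. 12.5 (3); [Cremona2006] Table 1.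
-/

set_option autoImplicit false
set_option linter.dupNamespace false

noncomputable section

open scoped Classical NumberField
open WeierstrassCurve NumberField Field IsDedekindDomain IntermediateField
  Literature.NumberTheory.EllipticCurves Literature.NumberTheory.EllipticCurves.Rank1Residual
  Literature.NumberTheory.EllipticCurves.Rank1Residual.Typed
  Literature.NumberTheory.GaloisRepresentations Literature.NumberTheory.NumberFields
  Literature.NumberTheory.SerreUniformity Literature.NumberTheory.IwasawaTheory
  Summit.BirchSwinnertonDyer.Rank1Residual Summit.BirchSwinnertonDyer.Rank1Residual.Additive
  Summit.BirchSwinnertonDyer.BirchSwinnertonDyer.Theorems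
  Summit.BirchSwinnertonDyer.BirchSwinnertonDyer.Theorems.AdditiveBranchIMCGordTwoRankOne
  Summit.BirchSwinnertonDyer.BirchSwinnertonDyer.Theorems.TameUpperUnitTwistRecords

namespace Summit.BirchSwinnertonDyer.BirchSwinnertonDyer.Theorems.TameFineSelmerStabilizerFukudaRecords

/-! ## §0 The road (door L8 with Fukuda's order test; Fukuda's index and tameness from «`ρ̄` irreducible, not onto»), any odd `p` -/

set_option synthInstance.maxHeartbeats 400000 in
set_option maxHeartbeats 4000000 in
/-- **(A) at `(W, p)` from TWO class numbers of the torsion-point field** (fact-free road of this file): `W/ℚ` elliptic, `p` odd, `W[p]` irreducible,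
`ρ̄_{W,p}` not onto (so `p ∤ #Gal(ℚ(W[p])/ℚ)` by Serre's Prop. 15: Fukuda index `0` at `ℚ(P) ⊆ ℚ(W[p])` and tameness, all kernel), `P ∈ W[p] ∖ 0`;
DISPLAYED: for every cyclotomic `ℤ_p`-extension `κ_P` of `ℚ(P) = ℚ̄^{Stab(P)}`, `ord_p h(ℚ(P)_{n+1}) = ord_p h(ℚ(P)_n)`.  Then statement (A) holds for
`W` at `p` over every cyclotomic `ℤ_p`-extension of `ℚ` (door L8 `CoatesSujatha2005.conjA_of_classNumberPExp_stabilizerField_succ_eq`: Fukuda Thm. 1 (1)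
at finite level ⟹ `μ = 0` ⟹ bounded ranks ⟹ Coates–Sujatha (A) via the torsion-point-field descent). [cite: CoatesSujatha2005, §3 Thm. 3.4 and Lemma 3.8]
[cite: Fukuda1994, Thm. 1 (1), p. 264] [cite: Washington1997, §13.3 Lemma 13.18 and Prop. 13.22] [cite: Serre1972, §2.4 Prop. 15] -/
theorem conjA_of_not_surjective_of_classNumberPExp_stabilizerField_succ_eq (W : WeierstrassCurve ℚ) [W.IsElliptic]
    (p : ℕ) [Fact p.Prime] (hp : p ≠ 2)
    (hirr : W.HasIrreducibleModPGaloisRep p) (hns : ¬ W.HasSurjectiveModNGaloisRep p)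
    (P : ↥(W.geomTorsion ((p : ℕ) : ℤ))) (hP0 : P ≠ 0) (n : ℕ)
    (hord : ∀ κP : ZpExtension ↥(fixedField (MulAction.stabilizer (absoluteGaloisGroup ℚ) P) :
        IntermediateField ℚ (AlgebraicClosure ℚ)) p, κP.IsCyclotomic →
        classNumberPExp κP (n + 1) = classNumberPExp κP n)
    (κ : ZpExtension ℚ p) (hκ : κ.IsCyclotomic) :
    ∃ (γ : absoluteGaloisGroup ℚ) (Df : W.FineSelmerDualData κ γ),
      Module.Finite ℤ_[p] (RestrictScalars ℤ_[p] (IwasawaAlgebra p) Df.X) := by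
  haveI : NeZero p := ⟨(Fact.out : p.Prime).ne_zero⟩
  have hG : ¬ p ∣ Nat.card ((W.divisionField p) ≃ₐ[ℚ] (W.divisionField p)) :=
    SmallImageDickson.not_dvd_card_aut_divisionField W p hirr hns
  have hle : fixedField (MulAction.stabilizer (absoluteGaloisGroup ℚ) P) ≤ W.divisionField p :=
    CoatesSujatha2005.fixedField_stabilizer_le_divisionField W P
  haveI : FiniteDimensional ℚ ↥(W.divisionField p) := W.finiteDimensional_divisionField p
  haveI : IsGalois ℚ ↥(W.divisionField p) := W.isGalois_divisionField p
  haveI : FiniteDimensional ℚ ↥(fixedField (MulAction.stabilizer (absoluteGaloisGroup ℚ) P)) :=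
    FiniteDimensional.of_injective (IntermediateField.inclusion hle).toLinearMap (IntermediateField.inclusion_injective hle)
  haveI : NumberField ↥(fixedField (MulAction.stabilizer (absoluteGaloisGroup ℚ) P)) := NumberField.mk
  exact CoatesSujatha2005.conjA_of_classNumberPExp_stabilizerField_succ_eq W hp hirr hG P hP0 n
    (fun κP hκP => CartanMuRoadFukudaDoorsTprime.totallyRamifiedFrom_zero_of_isCyclotomic_of_algHom_normal_of_not_dvd_card
      ↥(fixedField (MulAction.stabilizer (absoluteGaloisGroup ℚ) P)) (W.divisionField p) p hG (IntermediateField.inclusion hle) κP hκP)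
    hord κ hκ

set_option synthInstance.maxHeartbeats 400000 in
set_option maxHeartbeats 4000000 in
/-- **The same with the displayed datum EXISTENTIAL in `P`** (for images with more than one orbit on `W[p] ∖ 0`, e.g. `C_s⁺(p)`: the numerics
concern ONE orbit): `∃ P ≠ 0` with the two-layer order equality at `ℚ(P)` ⟹ statement (A) at `(W, p)`, in the typed carrier `ConjAAt W p`.
[cite: CoatesSujatha2005, §3 Thm. 3.4 and Lemma 3.8] [cite: Fukuda1994, Thm. 1 (1), p. 264] [cite: Serre1972, §2.4 Prop. 15] -/
theorem conjAAt_of_not_surjective_of_exists_classNumberPExp_stabilizerField_succ_eq (W : WeierstrassCurve ℚ) [W.IsElliptic]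
    (p : ℕ) [Fact p.Prime] (hp : p ≠ 2)
    (hirr : W.HasIrreducibleModPGaloisRep p) (hns : ¬ W.HasSurjectiveModNGaloisRep p) (n : ℕ)
    (hord : ∃ P : ↥(W.geomTorsion ((p : ℕ) : ℤ)), P ≠ 0 ∧
      ∀ κP : ZpExtension ↥(fixedField (MulAction.stabilizer (absoluteGaloisGroup ℚ) P) :
        IntermediateField ℚ (AlgebraicClosure ℚ)) p, κP.IsCyclotomic →
        classNumberPExp κP (n + 1) = classNumberPExp κP n) :
    ConjAAt W p := by
  obtain ⟨P, hP0, hordP⟩ := hord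
  intro κ hκ
  exact conjA_of_not_surjective_of_classNumberPExp_stabilizerField_succ_eq W p hp hirr hns P hP0 n hordP κ hκ

set_option synthInstance.maxHeartbeats 400000 in
set_option maxHeartbeats 4000000 in
/-- **U₀ `ord_p #Ш(W) ≤ ord_p #Ш(W)_an` from the same datum** (modulo the named facts `hKatoA` (Kato's fine-Selmer reading of 14.5 (3)), `hGZK`, `hmod`,
and Cremona's `r_an = 0`): `W/ℚ` minimal, `p` odd, `Addv W p`, `SubTprime W p`, `W[p]` irreducible, `ρ̄_{W,p}` not onto, and the displayed
existential two-layer order datum — then `MissingUpperBoundAt W p` (k8t-c4's route-free `CartanMuRoadDoorsTprimeFive.missingUpperBoundAt_tame_of_conjA`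
over the (A)-door above). CONDITIONAL; nothing booked; BSD proved for no curve. [cite: Kato2004Asterisque, Thm. 14.5 (3) (p. 236), Thm. 12.5 (3) (p. 222)]
[cite: CoatesSujatha2005, §3 Thm. 3.4] [cite: Fukuda1994, Thm. 1 (1), p. 264] [cite: Serre1972, §2.4 Prop. 15] -/
theorem missingUpperBoundAt_of_not_surjective_of_exists_classNumberPExp_stabilizerField_succ_eq
    (hKatoA : Kato2004.rankZero_padicValNat_sha_add_padicValNat_tamagawa_le_of_additive_potGood_of_irreducible_of_fineSelmerDual_fg)
    (hGZK : rank_eq_analyticRank_of_analyticRank_le_one) (hmod : hasEntireLFunction_rat)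
    (W : WeierstrassCurve ℚ) [W.IsElliptic] [W.IsGloballyMinimal] (p : ℕ) [Fact p.Prime] (hp : p ≠ 2) (hr : W.analyticRank = 0)
    (hadd : Addv W p) (hT : SubTprime W p)
    (hirr : W.HasIrreducibleModPGaloisRep p) (hns : ¬ W.HasSurjectiveModNGaloisRep p) (n : ℕ)
    (hord : ∃ P : ↥(W.geomTorsion ((p : ℕ) : ℤ)), P ≠ 0 ∧
      ∀ κP : ZpExtension ↥(fixedField (MulAction.stabilizer (absoluteGaloisGroup ℚ) P) :
        IntermediateField ℚ (AlgebraicClosure ℚ)) p, κP.IsCyclotomic →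
        classNumberPExp κP (n + 1) = classNumberPExp κP n) :
    MissingUpperBoundAt W p :=
  CartanMuRoadDoorsTprimeFive.missingUpperBoundAt_tame_of_conjA W hKatoA hGZK hmod p hr hp hadd hT hirr
    (conjAAt_of_not_surjective_of_exists_classNumberPExp_stabilizerField_succ_eq W p hp hirr hns n hord)

/-! ## §1 The rows -/

/-! ### `235200xb1` @ `p = 5` — `N = 235200 = 2^6·3·5^2·7^2`; Cremona: `r_an = 0`; (t′) at `5` (`e = 3`); ♯; image `5Ns` (Zywina `G₉`-line, kernel
`notSurjFive_g235200xb1`); E[5]-ISOTYPIC at layer 0 (k8t-c4 g26 j334494; `rank₅ Cl(ℚ(P)) = 1`, `rank₅ Cl(ℚ(x(P))) = 0`): every layer-0 door void.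
`ℚ(P)` (eigenline point) octic `y^8 - 4y^7 + 82y^6 - 92y^5 + 2240y^4 + 872y^3 + 33602y^2 + 24304y + 186921` (ONE prime above `5`, `h = 80 = 2^4·5`
CERTIFIED); LAYER 1 (conjA g15 kit j312330 + g13 j309704, GRH): degree 40, `h = 14080 = 2^8·5·11`, `ord₅ h = 1 = ord₅ h(ℚ(P))`: Fukuda's ORDER test
holds at `(0,1)`.  First roads: k8t-c4 unit-twist record `missingUpperBoundAt_g235200xb1_5` (U₀; displays Heegner-side facts); NO (A) record before
this file (Records03 `conjA_g235200xb1_5_selTriv[Raw]` VACUOUS). -/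

/-- **(A) AT `(235200xb1, 5)` — NO NAMED FACT** (door L8, Fukuda order test at `ℚ(P)`, layers `(0,1)`): KERNEL `irr_g235200xb1_5`, `notSurjFive_g235200xb1`;
DISPLAYED `hord` («there is `P ≠ 0` in `E[5]` with `ord₅ h(ℚ(P)₁) = ord₅ h(ℚ(P))` for every cyclotomic `κ_P`»; numerically: `P` on an eigenline of
the split Cartan group, `ℚ(P)` the octic above, `h = 80` CERTIFIED, `ord₅ h(ℚ(P)₁) = 1` GRH, kits j312330 / j309704). Per row; nothing booked;
(A)/BSD proved for no class. [cite: CoatesSujatha2005, §3 Thm. 3.4 and Lemma 3.8] [cite: Fukuda1994, Thm. 1 (1), p. 264] [cite: Serre1972, §2.4 Prop. 15]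
[cite: Zywina2015, Thm. 1.4] [cite: Cremona2006, Table 1 (Cremona label 235200xb1)] -/
theorem conjA_g235200xb1_5_L8e
    {W : WeierstrassCurve ℚ} [W.IsElliptic] (hWeq : W = (⟨0, 1, 0, (-224583), 40910463⟩ : WeierstrassCurve ℚ))
    (hord : ∃ P : ↥(W.geomTorsion ((5 : ℕ) : ℤ)), P ≠ 0 ∧
      ∀ κP : ZpExtension ↥(fixedField (MulAction.stabilizer (absoluteGaloisGroup ℚ) P) :
        IntermediateField ℚ (AlgebraicClosure ℚ)) 5, κP.IsCyclotomic →
        classNumberPExp κP (0 + 1) = classNumberPExp κP 0)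
    (κ : ZpExtension ℚ 5) (hκ : κ.IsCyclotomic) :
    ∃ (γ : absoluteGaloisGroup ℚ) (Df : W.FineSelmerDualData κ γ),
      Module.Finite ℤ_[5] (RestrictScalars ℤ_[5] (IwasawaAlgebra 5) Df.X) := by
  subst hWeq
  haveI : Fact (Nat.Prime 5) := ⟨by norm_num⟩
  exact conjAAt_of_not_surjective_of_exists_classNumberPExp_stabilizerField_succ_eq _ 5 (by decide)
    irr_g235200xb1_5 notSurjFive_g235200xb1 0 hord κ hκ

/-- **(A) AT `(235200xb1, 5)` in the typed carrier `ConjAAt`** (same datum, same road). [cite: CoatesSujatha2005, §3 Thm. 3.4 and Lemma 3.8]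
[cite: Fukuda1994, Thm. 1 (1), p. 264] [cite: Cremona2006, Table 1 (Cremona label 235200xb1)] -/
theorem conjAAt_g235200xb1_5_L8e
    {W : WeierstrassCurve ℚ} [W.IsElliptic] (hWeq : W = (⟨0, 1, 0, (-224583), 40910463⟩ : WeierstrassCurve ℚ))
    (hord : ∃ P : ↥(W.geomTorsion ((5 : ℕ) : ℤ)), P ≠ 0 ∧
      ∀ κP : ZpExtension ↥(fixedField (MulAction.stabilizer (absoluteGaloisGroup ℚ) P) :
        IntermediateField ℚ (AlgebraicClosure ℚ)) 5, κP.IsCyclotomic →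
        classNumberPExp κP (0 + 1) = classNumberPExp κP 0) :
    haveI : Fact (Nat.Prime 5) := ⟨by norm_num⟩; ConjAAt W 5 := by
  subst hWeq
  exact conjAAt_of_not_surjective_of_exists_classNumberPExp_stabilizerField_succ_eq _ 5 (by decide)
    irr_g235200xb1_5 notSurjFive_g235200xb1 0 hord

/-- **RECORD — U₀ `ord₅ #Ш(E) ≤ ord₅ #Ш(E)_an` for `E = 235200xb1` at `p = 5` on the fact-free door L8 / Fukuda order test at `ℚ(P)`** (♯ U₀-ns row of KT
items 19202 / 19982): KERNEL `addv_g235200xb1_5`, `subTprime_g235200xb1_5`, `irr_g235200xb1_5`, `notSurjFive_g235200xb1`; DISPLAYED named facts `hKatoA hGZK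
hmod` ONLY, Cremona's `r_an = 0` (`hr`), and `hord` (kits j312330 / j309704: `h(ℚ(P)) = 80` CERT, `ord₅ h(ℚ(P)₁) = 1` GRH). Per row; nothing booked;
BSD is not proved by this. [cite: Kato2004Asterisque, Thm. 14.5 (3) (p. 236), Thm. 12.5 (3) (p. 222)] [cite: CoatesSujatha2005, §3 Thm. 3.4]
[cite: Fukuda1994, Thm. 1 (1), p. 264] [cite: Cremona2006, Table 1 (Cremona label 235200xb1)] -/
theorem missingUpperBoundAt_g235200xb1_5_L8e
    (hKatoA : Kato2004.rankZero_padicValNat_sha_add_padicValNat_tamagawa_le_of_additive_potGood_of_irreducible_of_fineSelmerDual_fg)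
    (hGZK : rank_eq_analyticRank_of_analyticRank_le_one) (hmod : hasEntireLFunction_rat)
    {W : WeierstrassCurve ℚ} [W.IsElliptic] [W.IsGloballyMinimal] (hWeq : W = (⟨0, 1, 0, (-224583), 40910463⟩ : WeierstrassCurve ℚ))
    (hr : W.analyticRank = 0)
    (hord : ∃ P : ↥(W.geomTorsion ((5 : ℕ) : ℤ)), P ≠ 0 ∧
      ∀ κP : ZpExtension ↥(fixedField (MulAction.stabilizer (absoluteGaloisGroup ℚ) P) :
        IntermediateField ℚ (AlgebraicClosure ℚ)) 5, κP.IsCyclotomic →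
        classNumberPExp κP (0 + 1) = classNumberPExp κP 0) :
    MissingUpperBoundAt W 5 := by
  subst hWeq
  haveI : Fact (Nat.Prime 5) := ⟨by norm_num⟩
  exact missingUpperBoundAt_of_not_surjective_of_exists_classNumberPExp_stabilizerField_succ_eq hKatoA hGZK hmod _ 5 (by decide) hr
    addv_g235200xb1_5 subTprime_g235200xb1_5 irr_g235200xb1_5 notSurjFive_g235200xb1 0 hord

/-! ### `338800ex1` @ `p = 5` — `N = 338800 = 2^4·5^2·7·11^2`; Cremona: `r_an = 0`; (t′) at `5` (`e = 3`); ♯; image `5Ns` (Zywina `G₉`-line, kernel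
`notSurjFive_g338800ex1`); E[5]-ISOTYPIC at layer 0 (k8t-c4 g26 j334494; `rank₅ Cl(ℚ(P)) = 1`, `rank₅ Cl(ℚ(x(P))) = 0`): every layer-0 door void.
`ℚ(P)` (eigenline point) octic `x^8 + 605x^2 + 2420` (ONE prime above `5`, `h = 160 = 2^5·5`, `Cl = [40,2,2]`, CERTIFIED); LAYER 1 (conjA g9 kit j296284,
GRH): degree 40, `h = 11360 = 2^5·5·71`, `Cl = [2840,2,2]`, `ord₅ h = 1 = ord₅ h(ℚ(P))` («FUKUDA1(0,1): e=1»); second engine j336753 (this seat) agrees exactly.  First roads: k8t-c4 unit-twist record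
`missingUpperBoundAt_g338800ex1_5` (U₀; displays Heegner-side facts); NO (A) record before this file (Records03 `conjA_g338800ex1_5_selTriv[Raw]` VACUOUS). -/

/-- **(A) AT `(338800ex1, 5)` — NO NAMED FACT** (door L8, Fukuda order test at `ℚ(P)`, layers `(0,1)`): KERNEL `irr_g338800ex1_5`, `notSurjFive_g338800ex1`;
DISPLAYED `hord` («there is `P ≠ 0` in `E[5]` with `ord₅ h(ℚ(P)₁) = ord₅ h(ℚ(P))` for every cyclotomic `κ_P`»; numerically: `P` on an eigenline of
the split Cartan group, `ℚ(P) ≅ ℚ[x]/(x^8 + 605x^2 + 2420)`, `h = 160` CERTIFIED, `h(ℚ(P)₁) = 11360`, `ord₅ = 1` GRH, kits j296284 / j336753). Per row; nothing booked;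
(A)/BSD proved for no class. [cite: CoatesSujatha2005, §3 Thm. 3.4 and Lemma 3.8] [cite: Fukuda1994, Thm. 1 (1), p. 264] [cite: Serre1972, §2.4 Prop. 15]
[cite: Zywina2015, Thm. 1.4] [cite: Cremona2006, Table 1 (Cremona label 338800ex1)] -/
theorem conjA_g338800ex1_5_L8e
    {W : WeierstrassCurve ℚ} [W.IsElliptic] (hWeq : W = (⟨0, 0, 0, (-15950000), 24518230000⟩ : WeierstrassCurve ℚ))
    (hord : ∃ P : ↥(W.geomTorsion ((5 : ℕ) : ℤ)), P ≠ 0 ∧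
      ∀ κP : ZpExtension ↥(fixedField (MulAction.stabilizer (absoluteGaloisGroup ℚ) P) :
        IntermediateField ℚ (AlgebraicClosure ℚ)) 5, κP.IsCyclotomic →
        classNumberPExp κP (0 + 1) = classNumberPExp κP 0)
    (κ : ZpExtension ℚ 5) (hκ : κ.IsCyclotomic) :
    ∃ (γ : absoluteGaloisGroup ℚ) (Df : W.FineSelmerDualData κ γ),
      Module.Finite ℤ_[5] (RestrictScalars ℤ_[5] (IwasawaAlgebra 5) Df.X) := by
  subst hWeq
  haveI : Fact (Nat.Prime 5) := ⟨by norm_num⟩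
  exact conjAAt_of_not_surjective_of_exists_classNumberPExp_stabilizerField_succ_eq _ 5 (by decide)
    irr_g338800ex1_5 notSurjFive_g338800ex1 0 hord κ hκ

/-- **(A) AT `(338800ex1, 5)` in the typed carrier `ConjAAt`** (same datum, same road). [cite: CoatesSujatha2005, §3 Thm. 3.4 and Lemma 3.8]
[cite: Fukuda1994, Thm. 1 (1), p. 264] [cite: Cremona2006, Table 1 (Cremona label 338800ex1)] -/
theorem conjAAt_g338800ex1_5_L8e
    {W : WeierstrassCurve ℚ} [W.IsElliptic] (hWeq : W = (⟨0, 0, 0, (-15950000), 24518230000⟩ : WeierstrassCurve ℚ))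
    (hord : ∃ P : ↥(W.geomTorsion ((5 : ℕ) : ℤ)), P ≠ 0 ∧
      ∀ κP : ZpExtension ↥(fixedField (MulAction.stabilizer (absoluteGaloisGroup ℚ) P) :
        IntermediateField ℚ (AlgebraicClosure ℚ)) 5, κP.IsCyclotomic →
        classNumberPExp κP (0 + 1) = classNumberPExp κP 0) :
    haveI : Fact (Nat.Prime 5) := ⟨by norm_num⟩; ConjAAt W 5 := by
  subst hWeq
  exact conjAAt_of_not_surjective_of_exists_classNumberPExp_stabilizerField_succ_eq _ 5 (by decide)
    irr_g338800ex1_5 notSurjFive_g338800ex1 0 hord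

/-- **RECORD — U₀ `ord₅ #Ш(E) ≤ ord₅ #Ш(E)_an` for `E = 338800ex1` at `p = 5` on the fact-free door L8 / Fukuda order test at `ℚ(P)`** (♯ U₀-ns row of KT
items 19202 / 19982): KERNEL `addv_g338800ex1_5`, `subTprime_g338800ex1_5`, `irr_g338800ex1_5`, `notSurjFive_g338800ex1`; DISPLAYED named facts `hKatoA hGZK
hmod` ONLY, Cremona's `r_an = 0` (`hr`), and `hord` (kits j296284 / j336753: `h(ℚ(P)) = 160` CERT, `ord₅ h(ℚ(P)₁) = 1` GRH). Per row; nothing booked;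
BSD is not proved by this. [cite: Kato2004Asterisque, Thm. 14.5 (3) (p. 236), Thm. 12.5 (3) (p. 222)] [cite: CoatesSujatha2005, §3 Thm. 3.4]
[cite: Fukuda1994, Thm. 1 (1), p. 264] [cite: Cremona2006, Table 1 (Cremona label 338800ex1)] -/
theorem missingUpperBoundAt_g338800ex1_5_L8e
    (hKatoA : Kato2004.rankZero_padicValNat_sha_add_padicValNat_tamagawa_le_of_additive_potGood_of_irreducible_of_fineSelmerDual_fg)
    (hGZK : rank_eq_analyticRank_of_analyticRank_le_one) (hmod : hasEntireLFunction_rat)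
    {W : WeierstrassCurve ℚ} [W.IsElliptic] [W.IsGloballyMinimal] (hWeq : W = (⟨0, 0, 0, (-15950000), 24518230000⟩ : WeierstrassCurve ℚ))
    (hr : W.analyticRank = 0)
    (hord : ∃ P : ↥(W.geomTorsion ((5 : ℕ) : ℤ)), P ≠ 0 ∧
      ∀ κP : ZpExtension ↥(fixedField (MulAction.stabilizer (absoluteGaloisGroup ℚ) P) :
        IntermediateField ℚ (AlgebraicClosure ℚ)) 5, κP.IsCyclotomic →
        classNumberPExp κP (0 + 1) = classNumberPExp κP 0) :
    MissingUpperBoundAt W 5 := by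
  subst hWeq
  haveI : Fact (Nat.Prime 5) := ⟨by norm_num⟩
  exact missingUpperBoundAt_of_not_surjective_of_exists_classNumberPExp_stabilizerField_succ_eq hKatoA hGZK hmod _ 5 (by decide) hr
    addv_g338800ex1_5 subTprime_g338800ex1_5 irr_g338800ex1_5 notSurjFive_g338800ex1 0 hord

end Summit.BirchSwinnertonDyer.BirchSwinnertonDyer.Theorems.TameFineSelmerStabilizerFukudaRecords

end
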